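import Summits.CriticalPhenomena.SAWScalingLimit.Theorems.SAWDefectDecoherenceMassRatioMirrorDefs
import Summits.CriticalPhenomena.SAWScalingLimit.Theorems.SAWDefectDecoherenceMassRatioFlatRootGlue

/-!
# Glue of the line `mirror-doubling-endpoint-restriction` for the crux `SAWDefectDecoherence.MassRatio`
(stmt-CriticalPhenomena-8550; lead prover, crux protocol)

From the three registered stubs of the line — `CanonicalRestriction (3/4)` (the sharp content, in the
explicit doubled half-disc family), `RatioMixing` at every datum (frame avoidance ratio ≥ c × canonical
avoidance ratio at the matched scale, exponent `0`) and `InteriorHarnack 0` (bulk Harnack in the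
doubled domain, exponent `0`) — the theorem `massRatio_of_mirrorStubs` concludes
`SAWDefectDecoherence.MassRatio` by name. Glue lemmas: `Glue.endpointRestriction_of_canonical`
(`CanonicalRestriction t → RatioMixing → EndpointRestriction t`, every `t ≥ 0`), `Glue.massRatioAt_of`
(`InteriorHarnack s → EndpointRestriction t → FlatRoot.MassRatioAt (s + t)`, every split), `Glue.Z_mono`.
The registered sub-goal of the crux item proved here is `massRatio_of_mirrorStubs`. Sources: the line
card `Cruxes/MassRatio/Lines/mirror-doubling-endpoint-restriction.md` and its skeleton (planner
`planner-cruxplan-…-mirror-doubling-endp-0`, glue kernel-checked there; reproduced over the landed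
vocabulary `…MirrorDefs`, `…FlatRootDefs`, `…FlatRootGlue`). Deliberately NOT here: the three stubs.
-/

noncomputable section
namespace Summit.CriticalPhenomena.SAWScalingLimit.Theorems.MassRatio.Mirror

open Literature.Probability.LatticeModels Literature.Probability.RandomPlanarGeometry
open Literature.Probability.RandomPlanarGeometry.SAW
open Summit.CriticalPhenomena.SAWScalingLimit.Theses.SAWDefectDecoherence
open Summit.CriticalPhenomena.SAWScalingLimit.Theorems.MassRatio.Negative
open Summit.CriticalPhenomena.SAWScalingLimit.Theorems.MassRatio.Renewal (Z)
open Summit.CriticalPhenomena.SAWScalingLimit.Theorems.MassRatio.FlatRoot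
  (Frame MassRatioAt massK domainMono finsum_mem_mono)
open scoped Classical

namespace Glue

/-! ## Glue (proved) -/

/-- Monotonicity of the critical two-point mass in the domain (`FlatRoot.domainMono`, reordered). -/
theorem Z_mono {Λ Λ' : Finset HexVertex} (h : Λ ⊆ Λ') (a z : Sym2 HexVertex) :
    Z Λ a z ≤ Z Λ' a z :=
  domainMono Λ' Λ a z h

/-- **Composition 1: `CanonicalRestriction t → RatioMixing → EndpointRestriction t`** for every
`t ≥ 0`: with `R = ⌊ρ'/δ⌋ ≥ 1` eventually, `c Z_{Λ⁺} Z_H ≤ Z_Λ Z_{H⁺}` and `c₀ R^{-t} Z_{H⁺} ≤ Z_H`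
give `c c₀ R^{-t} Z_{Λ⁺} ≤ Z_Λ` (cancel `Z_{H⁺} > 0`, `canonical_pos` + `Z_mono`), and
`R^{-t} ≥ (ρ'/δ)^{-t} = ρ'^{-t} δ^{t}`. -/
theorem endpointRestriction_of_canonical {t : ℝ} (ht : 0 ≤ t) (hC : CanonicalRestriction t)
    (hM : ∀ (D : DobrushinDomain) (ρ : ℝ) (Λ : ℝ → Finset HexVertex) (m : ℝ → ℤ)
      (a b : ℝ → Sym2 HexVertex), RatioMixing D ρ Λ m a b) : EndpointRestriction t := by
  intro D ρ Λ m a b hF ρ' hρ' hρ'0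
  obtain ⟨c₀, hc₀, hcan⟩ := hC
  obtain ⟨c, hc, hmix⟩ := hM D ρ Λ m a b hF ρ' hρ' hρ'0
  refine ⟨c * c₀ * ρ' ^ (-t), by positivity, ?_⟩
  have hpos : ∀ᶠ δ : ℝ in nhdsWithin 0 (Set.Ioi 0), 0 < δ := eventually_mem_nhdsWithin
  have hsmall : ∀ᶠ δ : ℝ in nhdsWithin 0 (Set.Ioi 0), δ < ρ' :=
    Filter.mem_of_superset (Ioo_mem_nhdsGT hρ') fun δ hδ => hδ.2
  filter_upwards [hmix, hpos, hsmall] with δ hmixδ hδ hδρ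
  set R : ℕ := scaleR ρ' δ with hRdef
  have hR1 : 1 ≤ R := by
    show 1 ≤ ⌊ρ' / δ⌋₊
    apply Nat.le_floor
    rw [Nat.cast_one, le_div_iff₀ hδ]
    linarith
  have hRle : (R : ℝ) ≤ ρ' / δ := by
    show ((⌊ρ' / δ⌋₊ : ℕ) : ℝ) ≤ ρ' / δ
    exact Nat.floor_le (by positivity)
  have hRpos : (0 : ℝ) < R := Nat.cast_pos.2 (by omega)
  have hcanR := hcan R hR1
  have hZHp : 0 < Z (double (canonDisc R) cEdge R) (aEdge R) cEdge :=
    lt_of_lt_of_le (canonical_pos R hR1) (Z_mono (subset_double _ _ _) _ _)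
  set ZΛ := Z (Λ δ) (a δ) (b δ)
  set ZΛp := Z (double (Λ δ) (b δ) (R : ℝ)) (a δ) (b δ)
  set ZH := Z (canonDisc R) (aEdge R) cEdge
  set ZHp := Z (double (canonDisc R) cEdge R) (aEdge R) cEdge
  have hZΛp : 0 ≤ ZΛp := norm_nonneg _
  have h1 : c * c₀ * (R : ℝ) ^ (-t) * ZΛp * ZHp ≤ ZΛ * ZHp :=
    calc c * c₀ * (R : ℝ) ^ (-t) * ZΛp * ZHp = (c * ZΛp) * (c₀ * (R : ℝ) ^ (-t) * ZHp) := by ring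
      _ ≤ (c * ZΛp) * ZH := mul_le_mul_of_nonneg_left hcanR (mul_nonneg hc.le hZΛp)
      _ = c * (ZΛp * ZH) := by ring
      _ ≤ ZΛ * ZHp := hmixδ
  have h2 : c * c₀ * (R : ℝ) ^ (-t) * ZΛp ≤ ZΛ := le_of_mul_le_mul_right h1 hZHp
  have hRt : (ρ' / δ) ^ (-t) ≤ (R : ℝ) ^ (-t) :=
    Real.rpow_le_rpow_of_nonpos hRpos hRle (by linarith)
  have hsplit : (ρ' / δ) ^ (-t) = ρ' ^ (-t) * δ ^ t := by
    rw [Real.div_rpow hρ'.le hδ.le, Real.rpow_neg hδ.le, div_inv_eq_mul]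
  calc c * c₀ * ρ' ^ (-t) * δ ^ t * ZΛp = c * c₀ * (ρ' / δ) ^ (-t) * ZΛp := by
        rw [hsplit]; ring
    _ ≤ c * c₀ * (R : ℝ) ^ (-t) * ZΛp := by
        apply mul_le_mul_of_nonneg_right _ hZΛp
        exact mul_le_mul_of_nonneg_left hRt (by positivity)
    _ ≤ ZΛ := h2

/-- **Composition 2 (the card's First lemma at a general cut): interior Harnack at exponent `s` and
the endpoint restriction at exponent `t` give the crux at the cut `s + t`** —
`δ²Σ_K Z_Λ ≤ δ²Σ_K Z_{Λ⁺} ≤ C δ^{-s} Z_{Λ⁺}(b_δ) ≤ (C/c) δ^{-s-t} Z_Λ(b_δ)` with `Λ⁺` the doubling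
at the radius cap `ρ' = rhoCap`. -/
theorem massRatioAt_of (s t : ℝ) (hH : InteriorHarnack s) (hR : EndpointRestriction t) :
    MassRatioAt (s + t) := by
  intro D ρ Λ m a b hF K hK hKD
  have hρ0 : 0 < rhoCap D ρ := rhoCap_pos D hF.1
  obtain ⟨C, hC⟩ := hH D ρ Λ m a b hF (rhoCap D ρ) hρ0 le_rfl K hK hKD
  obtain ⟨c, hc, hcR⟩ := hR D ρ Λ m a b hF (rhoCap D ρ) hρ0 le_rfl
  refine ⟨max C 0 / c, ?_⟩
  have hpos : ∀ᶠ δ : ℝ in nhdsWithin 0 (Set.Ioi 0), 0 < δ := eventually_mem_nhdsWithin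
  filter_upwards [hC, hcR, hpos] with δ hCδ hRδ hδ
  unfold massK
  set Λp := double (Λ δ) (b δ) (scaleR (rhoCap D ρ) δ) with hΛp
  set S : Set (Sym2 HexVertex) :=
    {e : Sym2 HexVertex | e ∈ hexDomainMidEdges (Λ δ) ∧ (δ : ℂ) * hexMidpoint e ∈ K} with hSdef
  have hSfin : S.Finite := (hexDomainMidEdges_finite (Λ δ)).subset fun e he => he.1
  have h1 : ∑ᶠ e ∈ S, Z (Λ δ) (a δ) e ≤ ∑ᶠ e ∈ S, Z Λp (a δ) e :=
    finsum_mem_mono hSfin fun e _ => Z_mono (subset_double _ _ _) _ _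
  have hZp0 : 0 ≤ Z Λp (a δ) (b δ) := norm_nonneg _
  have hrpow : (0 : ℝ) < δ ^ (-s) := Real.rpow_pos_of_pos hδ _
  have hrpow' : (0 : ℝ) < δ ^ t := Real.rpow_pos_of_pos hδ _
  have h2 : δ ^ 2 * ∑ᶠ e ∈ S, Z Λp (a δ) e ≤ max C 0 * δ ^ (-s) * Z Λp (a δ) (b δ) :=
    hCδ.trans (by gcongr; exact le_max_left _ _)
  have h3 : Z Λp (a δ) (b δ) ≤ Z (Λ δ) (a δ) (b δ) / (c * δ ^ t) := by
    rw [le_div_iff₀ (mul_pos hc hrpow')]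
    calc Z Λp (a δ) (b δ) * (c * δ ^ t) = c * δ ^ t * Z Λp (a δ) (b δ) := by ring
      _ ≤ Z (Λ δ) (a δ) (b δ) := hRδ
  have hexp : δ ^ (-s) / δ ^ t = δ ^ (-(s + t)) := by
    rw [← Real.rpow_sub hδ]
    congr 1; ring
  calc δ ^ 2 * ∑ᶠ e ∈ S, Z (Λ δ) (a δ) e
      ≤ δ ^ 2 * ∑ᶠ e ∈ S, Z Λp (a δ) e := by gcongr
    _ ≤ max C 0 * δ ^ (-s) * Z Λp (a δ) (b δ) := h2
    _ ≤ max C 0 * δ ^ (-s) * (Z (Λ δ) (a δ) (b δ) / (c * δ ^ t)) :=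
        mul_le_mul_of_nonneg_left h3 (mul_nonneg (le_max_right _ _) hrpow.le)
    _ = max C 0 / c * (δ ^ (-s) / δ ^ t) * Z (Λ δ) (a δ) (b δ) := by
        field_simp
    _ = max C 0 / c * δ ^ (-(s + t)) * Z (Λ δ) (a δ) (b δ) := by rw [hexp]

end Glue

open Glue

/-! ## Composition: the line concludes the crux from its three registered stubs -/

/-- **The line `mirror-doubling-endpoint-restriction` concludes the crux from its three open
statements** (the registered stubs of the crux item: `stub_canonicalRestriction` is
`CanonicalRestriction (3/4)`, `stub_ratioMixing` is `RatioMixing` at every datum,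
`stub_interiorHarnack` is `InteriorHarnack 0`): ratio mixing transfers the canonical restriction
bound to `EndpointRestriction (3/4)` in the frame (`Glue.endpointRestriction_of_canonical`), the
interior Harnack at exponent `0` composes with it to `MassRatioAt (0 + 3/4)` (`Glue.massRatioAt_of`),
which is the crux (`FlatRoot.Glue.massRatio_of_massRatioAt`, landed). Registered sub-goal
`massRatio_of_mirrorStubs` of the crux item. -/
theorem massRatio_of_mirrorStubs : CanonicalRestriction (3 / 4) → (∀ (D : DobrushinDomain) (ρ : ℝ) (Λ : ℝ → Finset HexVertex) (m : ℝ → ℤ) (a b : ℝ → Sym2 HexVertex), RatioMixing D ρ Λ m a b) → InteriorHarnack 0 → MassRatio := by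
  intro hC hM hH
  have hER : EndpointRestriction (3 / 4) := endpointRestriction_of_canonical (by norm_num) hC hM
  have h : MassRatioAt (0 + 3 / 4) := massRatioAt_of 0 (3 / 4) hH hER
  have e : (0 : ℝ) + 3 / 4 = 3 / 4 := by norm_num
  rw [e] at h
  exact FlatRoot.Glue.massRatio_of_massRatioAt h

end Summit.CriticalPhenomena.SAWScalingLimit.Theorems.MassRatio.Mirror
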